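import Summits.BirchSwinnertonDyer.BirchSwinnertonDyer.Theorems.AdditiveKolyvaginRoadLevelSystemsSyntheticCore
import Summits.BirchSwinnertonDyer.BirchSwinnertonDyer.Theorems.AdditiveKolyvaginRoadLevelSystemsEvenLevels
import Summits.BirchSwinnertonDyer.BirchSwinnertonDyer.Theorems.AdditiveKolyvaginRoadLevelMembership
import Summits.BirchSwinnertonDyer.BirchSwinnertonDyer.Theorems.AdditiveKolyvaginRoadLevelRealisation
import Summits.BirchSwinnertonDyer.BirchSwinnertonDyer.Theorems.AdditiveKolyvaginRoadLevelBasics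
import Summits.BirchSwinnertonDyer.BirchSwinnertonDyer.Theorems.AdditiveKolyvaginRoadInductionOfLevelSystemsDict
import Summits.BirchSwinnertonDyer.BirchSwinnertonDyer.Theorems.AdditiveKolyvaginRoadKolyvaginSignedSupply
import HarnessLib

/-!
# Route `AdditiveKolyvaginRoad`, crux `LevelKolyvaginSystemsAdditive` (item stmt-BirchSwinnertonDyer-21396, KS′):
# the carrier `LevelKolyvaginSystemP` at a frame FROM THE TARGET'S CONCLUSION AT THAT FRAME (KPA′-at-frame) and the
# E-side Selmer dichotomies alone — the SYNTHETIC level Kolyvagin system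
# (cell `pub/bsd-wall`, lead prover `cruxlead-stmt-BirchSwinnertonDyer-21396` g2; `--supports stmt-BirchSwinnertonDyer-21396`,
# helper; part 2 of 2, after `…LevelSystemsSyntheticCore`)

WHY (structural finding of the lead, g2). The carrier `LevelKolyvaginSystemP W K p Dt β ι c` (`…LevelSystems`) pins GENUINE
Kolyvagin classes `d.kolyvaginClass` ONLY at the bottom level `n = ∅` (`realisation`). Every field at a NON-EMPTY level —
`sign`, `selmer_off`, `selmer_inf`, `toric_on`, `transverse_on`, `relation` (8.1), `baseCase` (Thm 7.2) — constrains the classes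
`κ m n` through the LEVEL-`n` SELMER STRUCTURES of `E[p]` (toric above `n`, transverse above `m`, Kummer elsewhere) and nothing
else: no field says that `κ m n` is a level-raised Heegner class. The ONE bridge between the genuine bottom and the synthetic
floors is `transport` (Thm 4.3) from level `∅`, whose conclusion `∃ m, κ m ∅ ≠ 0` is LITERALLY the conclusion of the route's
target `KolyvaginPrimitiveAdditive` (KPA′, stmt-BirchSwinnertonDyer-21400) at the frame. Consequently the carrier is
inhabited by the SYNTHETIC system of part 1 as soon as KPA′ holds at the frame and the E-side dichotomies hold — with NO level
raising, NO Bertolini–Darmon reciprocity law, NO Ihara ∕ multiplicity-one input, NO rank-0 anchor and NO W. Zhang datum. This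
file proves exactly that, as a kernel-checked statement for the planners: KS′-as-typed at a frame ⟸ KPA′-at-frame + E-side
Selmer algebra. (With the route's composition `kolyvaginPrimitiveAdditive_of_levelSystems` — KS′ ∧ BOT′ ∧ PUB ∧ DUAL ⟹ KPA′ —
and `bottomRankOneAdditive_of_kolyvaginPrimitiveAdditive`, KS′-as-typed is EQUIVALENT to KPA′ modulo published E-side
inputs: the typed crux isolates none of W. Zhang's p²-level mathematics. Re-typing with PROVENANCE rows — `κ m n` realises the
level-raised classes `c_p(∏m, ∏n)` on `X_{N⁺p², N⁻∏n}` at EVERY level — is the repair; see the lead's crux workfile.)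

WHAT.
* `nonempty_levelKolyvaginSystemP_of_selmerDichotomy` — at a frame (`K` imaginary quadratic, Heegner hypothesis,
  `4N ∣ β² − d_K`, so that Kolyvagin–Heegner data of every Kolyvagin conductor exist): for ANY family
  `𝒮 n m μ ≤ H¹(K, E[p])` with the MEMBERSHIP DICTIONARY of the level-`n` `μ`-eigen Selmer space transverse on `m` (binder
  `h𝒮`, definitional for the intended family), finite-dimensional, satisfying the two E-side dichotomy binders — (K) at a
  Kolyvagin prime `ℓ ∉ m` [(Lower): a class of `𝒮 n m μ` detected above `ℓ` ⟹ `𝒮 n (m∪ℓ) μ` is locally trivial above `ℓ`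
  and of dimension one less; (Raise): none detected ⟹ dimension one more — Mazur–Rubin Lemma 4.1.7 ∕ W. Zhang Lemma 8.2,
  8.4 ∕ the LOC package shape, E-side, Poitou–Tate] and (A²) the TWO-STEP admissible lowering [total rank one at
  `n ∪ {q₁,q₂}` with a generator NOT locally trivial above `q₂` ⟹ total rank one at `n` — W. Zhang Lemma 5.3 ∕ Prop. 5.4 for
  the structure transverse on `m`; E-side, Poitou–Tate] — and the conclusion of KPA′ at the frame (`∃ n d, KolSupp n ∧
  d.kolyvaginClass ≠ 0`), the carrier is inhabited: `Nonempty (LevelKolyvaginSystemP W K p Dt β ι c)`.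
* `exists_transverseLevelSpaces` — the intended family EXISTS with its dictionary and is finite-dimensional (the canonical
  space `levelSelmerSubgroupP` relaxed at the Kolyvagin primes of `m`, cut by `transverseLocalKerP` above them), so the binder
  `h𝒮` is not a restriction.

HONEST FRAMING: theorems only; 0 definitions, 0 named facts, 0 `sorry`; CONDITIONAL on the displayed binders (K), (A²) — E-side
Selmer algebra of `E[p]` over `K` at auxiliary primes, of the kind landed for `m = ∅` (`selQP_lower_of_detected`,
`selQP_raise_free`, `exists_relaxed_notMem_torsionLocalKer_of_admQ`, LOC `kolyvaginLocalPackageP_of_poitouTate`, all modulo the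
named Poitou–Tate fact) — and on KPA′-at-frame; closes nothing. It does NOT prove KS′ (KPA′ is open at `p² ∣ N`); it shows
what KS′-as-typed is worth. BSD is not proved by any of this.

References: [cite: WZhang2014, §3.9 (3.30), Thm. 4.3, Lemma 5.3, Prop. 5.4, Thm. 7.2, §8.1 (8.1), Lemma 8.2, Lemma 8.4, §9]
[cite: MazurRubin2004, Lemma 4.1.7, Prop. 4.5.8] [cite: Howard2006Bipartite, Cor. 2.3.5] [cite: GrossLMS1991, §3, Prop. 6.2]
[cite: BertoliniDarmon2005, §2.2–§2.3].
-/

-- single-conjunct summit: `Summit.BirchSwinnertonDyer.BirchSwinnertonDyer.…` repeats the name by design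
set_option linter.dupNamespace false

noncomputable section

open scoped Classical

namespace Summit.BirchSwinnertonDyer.BirchSwinnertonDyer.Theorems.AdditiveKoly

open WeierstrassCurve NumberField IsDedekindDomain
  Literature.NumberTheory.EllipticCurves Literature.NumberTheory.EllipticCurves.ModularForms
  Literature.NumberTheory.GaloisRepresentations Module
  Summit.BirchSwinnertonDyer.Rank1Residual.X11b.Three.Koly

variable (W : WeierstrassCurve ℚ) (K : Type) [Field K] [NumberField K] (p : ℕ) [W.IsElliptic] [W.IsGloballyMinimal]
  [NeZero (W.conductorNorm ℤ)] [Fact p.Prime]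
  (Dt : ModularParametrizationData W (W.conductorNorm ℤ)) (β : ℤ) (ι : K →+* ℂ) (c : K ≃ₐ[ℚ] K)
  [Module (ZMod p) (Vp W K p)]

/-! ## §1 The carrier from KPA′-at-frame and the E-side dichotomies -/

/-- **The SYNTHETIC level Kolyvagin system: `LevelKolyvaginSystemP` at a frame from KPA′-at-frame and the E-side Selmer
dichotomies.** `𝒮 n m μ` is any family with the membership dictionary `h𝒮` of the level-`n` `μ`-eigen Selmer space of `E[p]`
TRANSVERSE on the Kolyvagin primes of `m` (toric above `n`, Kummer elsewhere), finite-dimensional; (K) = the Kolyvagin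
dichotomy (Lower) ∕ (Raise) at non-empty even levels; (A²) = the two-step admissible lowering between even levels; `hKPA` = the
conclusion of `KolyvaginPrimitiveAdditive` at the frame. Construction: at level `∅` the genuine classes (the KPA′ witness at
its conductor, any Kolyvagin–Heegner datum elsewhere); at a non-empty even level `n` part 1's synthetic family of `𝒮 n`
(`κ m n :=` a generator of the total-rank-one space, else `0`; `ε₀ n :=` the parity sign); odd levels carry `0`
(`nonempty_levelKolyvaginSystemP_of_evenLevels`). `transport` between even levels is (A²) read through «`κ ≠ 0 ⟺` total rank
one»; `transport` to level `∅` is `hKPA`; `baseCase` is «total rank one ⟹ generator `≠ 0`»; `relation` is part 1's.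
[cite: WZhang2014, Thm. 4.3, Lemma 5.3, Prop. 5.4, Thm. 7.2, §8.1 (8.1), Lemma 8.2, Lemma 8.4]
[cite: MazurRubin2004, Lemma 4.1.7, Prop. 4.5.8] -/
theorem nonempty_levelKolyvaginSystemP_of_selmerDichotomy (hK : IsImaginaryQuadratic K)
    (hH : SatisfiesHeegnerHypothesis (W.conductorNorm ℤ) K)
    (hβ : (4 * (W.conductorNorm ℤ : ℤ)) ∣ β ^ 2 - NumberField.discr K)
    (𝒮 : Finset (AdmQ W K p) → Finset {ℓ // Zhang2014.IsKolyvaginPrime (W.conductorNorm ℤ) W K p ℓ} → Bool →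
      Submodule (ZMod p) (Vp W K p))
    (h𝒮 : ∀ (n : Finset (AdmQ W K p)) (m : Finset {ℓ // Zhang2014.IsKolyvaginPrime (W.conductorNorm ℤ) W K p ℓ})
      (μ : Bool) (x : Vp W K p), x ∈ 𝒮 n m μ ↔
        conjAct W c ((p ^ 1 : ℕ) : ℤ) x = sgnP μ • x ∧
        (∀ w : InfinitePlace K, x ∈ selmerLocalKer (W.baseChange K) w.Completion ((p ^ 1 : ℕ) : ℤ)) ∧
        (∀ v : HeightOneSpectrum (𝓞 K), (∀ ℓ ∈ m, ((ℓ : ℕ) : 𝓞 K) ∉ v.asIdeal) → (∀ q ∈ n, ((q : ℕ) : 𝓞 K) ∉ v.asIdeal) →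
          x ∈ selmerLocalKer (W.baseChange K) (v.adicCompletion K) ((p ^ 1 : ℕ) : ℤ)) ∧
        (∀ q ∈ n, ∀ v : HeightOneSpectrum (𝓞 K), ((q : ℕ) : 𝓞 K) ∈ v.asIdeal →
          x ∈ toricLocalKer (W.baseChange K) (v.adicCompletion K) ((p ^ 1 : ℕ) : ℤ)) ∧
        (∀ ℓ ∈ m, ∀ v : HeightOneSpectrum (𝓞 K), ((ℓ : ℕ) : 𝓞 K) ∈ v.asIdeal → x ∈ transverseLocalKerP W K p ι ℓ v))
    (hfin : ∀ n m μ, Module.Finite (ZMod p) (𝒮 n m μ))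
    (hLower : ∀ (n : Finset (AdmQ W K p)), n.Nonempty → Even n.card →
      ∀ (m : Finset {ℓ // Zhang2014.IsKolyvaginPrime (W.conductorNorm ℤ) W K p ℓ})
        (ℓ : {ℓ // Zhang2014.IsKolyvaginPrime (W.conductorNorm ℤ) W K p ℓ}) (μ : Bool) (v : HeightOneSpectrum (𝓞 K)),
        ℓ ∉ m → ((ℓ : ℕ) : 𝓞 K) ∈ v.asIdeal →
        (∃ x ∈ 𝒮 n m μ, x ∉ (W.baseChange K).torsionLocalKer (v.adicCompletion K) ((p ^ 1 : ℕ) : ℤ)) →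
        (∀ y ∈ 𝒮 n (insert ℓ m) μ, y ∈ (W.baseChange K).torsionLocalKer (v.adicCompletion K) ((p ^ 1 : ℕ) : ℤ)) ∧
          finrank (ZMod p) (𝒮 n (insert ℓ m) μ) + 1 = finrank (ZMod p) (𝒮 n m μ))
    (hRaise : ∀ (n : Finset (AdmQ W K p)), n.Nonempty → Even n.card →
      ∀ (m : Finset {ℓ // Zhang2014.IsKolyvaginPrime (W.conductorNorm ℤ) W K p ℓ})
        (ℓ : {ℓ // Zhang2014.IsKolyvaginPrime (W.conductorNorm ℤ) W K p ℓ}) (μ : Bool) (v : HeightOneSpectrum (𝓞 K)),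
        ℓ ∉ m → ((ℓ : ℕ) : 𝓞 K) ∈ v.asIdeal →
        (∀ x ∈ 𝒮 n m μ, x ∈ (W.baseChange K).torsionLocalKer (v.adicCompletion K) ((p ^ 1 : ℕ) : ℤ)) →
        finrank (ZMod p) (𝒮 n (insert ℓ m) μ) = finrank (ZMod p) (𝒮 n m μ) + 1)
    (hTwoStep : ∀ (n : Finset (AdmQ W K p)) (q₁ q₂ : AdmQ W K p), n.Nonempty → Even n.card → q₁ ∉ n → q₂ ∉ insert q₁ n →
      ∀ (m : Finset {ℓ // Zhang2014.IsKolyvaginPrime (W.conductorNorm ℤ) W K p ℓ}) (μ : Bool),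
        finrank (ZMod p) (𝒮 (insert q₂ (insert q₁ n)) m true) + finrank (ZMod p) (𝒮 (insert q₂ (insert q₁ n)) m false) = 1 →
        (∃ g ∈ 𝒮 (insert q₂ (insert q₁ n)) m μ, ∃ v : HeightOneSpectrum (𝓞 K), ((q₂ : ℕ) : 𝓞 K) ∈ v.asIdeal ∧
          g ∉ (W.baseChange K).torsionLocalKer (v.adicCompletion K) ((p ^ 1 : ℕ) : ℤ)) →
        finrank (ZMod p) (𝒮 n m true) + finrank (ZMod p) (𝒮 n m false) = 1)
    (hKPA : ∃ (N : ℕ) (d : KolyvaginHeegnerData Dt β ι N),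
      KolyvaginDescent.KolSupp (Zhang2014.IsKolyvaginPrime (W.conductorNorm ℤ) W K p) N ∧
        d.kolyvaginClass (Fact.out : p.Prime) 1 ≠ 0) :
    Nonempty (LevelKolyvaginSystemP W K p Dt β ι c) := by
  have hp : p.Prime := Fact.out
  -- §a the places `λ = (ℓ)` of the (inert) Kolyvagin primes and the classes locally trivial above them
  let plK : {ℓ // Zhang2014.IsKolyvaginPrime (W.conductorNorm ℤ) W K p ℓ} → HeightOneSpectrum (𝓞 K) := fun ℓ ↦
    ⟨Ideal.span {((ℓ : ℕ) : 𝓞 K)}, ℓ.2.2.2.2.2.1, by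
      rw [Ne, Ideal.span_singleton_eq_bot]; exact_mod_cast ℓ.2.1.ne_zero⟩
  have hplK : ∀ ℓ, ((ℓ : ℕ) : 𝓞 K) ∈ (plK ℓ).asIdeal := fun ℓ ↦ Ideal.mem_span_singleton_self _
  have hplace : ∀ (ℓ : {ℓ // Zhang2014.IsKolyvaginPrime (W.conductorNorm ℤ) W K p ℓ}) (v : HeightOneSpectrum (𝓞 K)),
      ((ℓ : ℕ) : 𝓞 K) ∈ v.asIdeal → v = plK ℓ := fun ℓ v hv ↦ by
    by_contra hne
    exact (ne_plK_iff_not_mem W K p plK hplK ℓ v).mp hne hv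
  let Z : {ℓ // Zhang2014.IsKolyvaginPrime (W.conductorNorm ℤ) W K p ℓ} → Submodule (ZMod p) (Vp W K p) := fun ℓ ↦
    AddSubgroup.toZModSubmodule p ((W.baseChange K).torsionLocalKer ((plK ℓ).adicCompletion K) ((p ^ 1 : ℕ) : ℤ))
  have hZ : ∀ (ℓ : {ℓ // Zhang2014.IsKolyvaginPrime (W.conductorNorm ℤ) W K p ℓ}) (x : Vp W K p),
      x ∈ Z ℓ ↔ x ∈ (W.baseChange K).torsionLocalKer ((plK ℓ).adicCompletion K) ((p ^ 1 : ℕ) : ℤ) :=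
    fun ℓ x ↦ AddSubgroup.mem_toZModSubmodule p
  -- §b descent (Out) from the dictionary: a class transverse above `ℓ` and locally trivial there is Kummer there
  have hOut : ∀ (n : Finset (AdmQ W K p)) (m : Finset {ℓ // Zhang2014.IsKolyvaginPrime (W.conductorNorm ℤ) W K p ℓ})
      (ℓ : {ℓ // Zhang2014.IsKolyvaginPrime (W.conductorNorm ℤ) W K p ℓ}) (μ : Bool), ℓ ∉ m →
      ∀ z ∈ 𝒮 n (insert ℓ m) μ, z ∈ Z ℓ → z ∈ 𝒮 n m μ := by
    intro n m ℓ μ hℓm z hz hzZ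
    rw [hZ] at hzZ
    obtain ⟨hs, hinf, hoff, htor, htr⟩ := (h𝒮 n (insert ℓ m) μ z).mp hz
    refine (h𝒮 n m μ z).mpr ⟨hs, hinf, fun v hvm hvn ↦ ?_, htor, fun ℓ' hℓ' v hv ↦ htr ℓ' (Finset.mem_insert_of_mem hℓ') v hv⟩
    by_cases hvℓ : ((ℓ : ℕ) : 𝓞 K) ∈ v.asIdeal
    · rw [hplace ℓ v hvℓ]
      exact (W.baseChange K).torsionLocalKer_le_selmerLocalKer _ _ hzZ
    · refine hoff v (fun ℓ' hℓ' ↦ ?_) hvn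
      rcases Finset.mem_insert.mp hℓ' with rfl | hℓ'
      · exact hvℓ
      · exact hvm ℓ' hℓ'
  -- §c the synthetic family at every non-empty even level (part 1)
  have hsyn : ∀ n : Finset (AdmQ W K p), n.Nonempty → Even n.card →
      ∃ (ε₀ : Bool) (κ : Finset {ℓ // Zhang2014.IsKolyvaginPrime (W.conductorNorm ℤ) W K p ℓ} → Vp W K p),
        (∀ m, κ m ∈ 𝒮 n m (ε₀ ^^ Nat.bodd m.card)) ∧
        (∀ m, κ m ≠ 0 ↔ finrank (ZMod p) (𝒮 n m true) + finrank (ZMod p) (𝒮 n m false) = 1) ∧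
        (∀ m ℓ, ℓ ∉ m → (κ (insert ℓ m) ∈ Z ℓ ↔ κ m ∈ Z ℓ)) := by
    intro n hn he
    refine Synthetic.exists_synthetic (𝒮 n) Z (hfin n) (fun m ℓ μ hℓm hx ↦ ?_) (fun m ℓ μ hℓm hx ↦ ?_)
      (fun m ℓ μ hℓm z hz hzZ ↦ hOut n m ℓ μ hℓm z hz hzZ)
    · obtain ⟨x, hx, hxZ⟩ := hx
      rw [hZ] at hxZ
      obtain ⟨hall, hrank⟩ := hLower n hn he m ℓ μ (plK ℓ) hℓm (hplK ℓ) ⟨x, hx, hxZ⟩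
      exact ⟨fun y hy ↦ (hZ ℓ y).mpr (hall y hy), hrank⟩
    · exact hRaise n hn he m ℓ μ (plK ℓ) hℓm (hplK ℓ) (fun x hx' ↦ (hZ ℓ x).mp (hx x hx'))
  -- §d the genuine bottom classes, the KPA′ witness at its conductor
  obtain ⟨N, dN, hsupp, hdN⟩ := hKPA
  -- the conductor of the witness as a finite set of Kolyvagin primes
  let m₀ : Finset {ℓ // Zhang2014.IsKolyvaginPrime (W.conductorNorm ℤ) W K p ℓ} :=
    N.primeFactors.subtype (Zhang2014.IsKolyvaginPrime (W.conductorNorm ℤ) W K p)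
  have hm₀ : ∏ ℓ ∈ m₀, (ℓ : ℕ) = N :=
    (Finset.prod_subtype_of_mem (s := N.primeFactors) (fun q : ℕ ↦ q) fun q hq ↦ hsupp.2 q hq).trans
      (Nat.prod_primeFactors_of_squarefree hsupp.1)
  have hwit : ∃ d₀ : KolyvaginHeegnerData Dt β ι (∏ ℓ ∈ m₀, (ℓ : ℕ)), d₀.kolyvaginClass hp 1 ≠ 0 := by
    have key : ∀ (M : ℕ) (d : KolyvaginHeegnerData Dt β ι M), d.kolyvaginClass hp 1 ≠ 0 → M = ∏ ℓ ∈ m₀, (ℓ : ℕ) →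
        ∃ d₀ : KolyvaginHeegnerData Dt β ι (∏ ℓ ∈ m₀, (ℓ : ℕ)), d₀.kolyvaginClass hp 1 ≠ 0 := by
      intro M d hd hM
      subst hM
      exact ⟨d, hd⟩
    exact key N dN hdN hm₀.symm
  let w₀ : Vp W K p := hwit.choose.kolyvaginClass hp 1
  let κgen : Finset {ℓ // Zhang2014.IsKolyvaginPrime (W.conductorNorm ℤ) W K p ℓ} → Vp W K p := fun m ↦
    if m = m₀ then w₀
    else (Classical.choice (nonempty_kolyvaginHeegnerData_finsetProd W K p hK hH Dt β ι hβ m)).kolyvaginClass hp 1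
  have hκgen₀ : κgen m₀ ≠ 0 := by
    have h : κgen m₀ = w₀ := if_pos rfl
    rw [h]
    exact hwit.choose_spec
  have hκgen : ∀ m : Finset {ℓ // Zhang2014.IsKolyvaginPrime (W.conductorNorm ℤ) W K p ℓ},
      ∃ d : KolyvaginHeegnerData Dt β ι (∏ ℓ ∈ m, (ℓ : ℕ)), κgen m = d.kolyvaginClass hp 1 := by
    intro m
    by_cases hm : m = m₀
    · subst hm
      exact ⟨hwit.choose, if_pos rfl⟩
    · exact ⟨_, if_neg hm⟩
  -- §e the classes and signs at all levels
  let ε₀ : Finset (AdmQ W K p) → Bool := fun n ↦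
    if h : n.Nonempty ∧ Even n.card then (hsyn n h.1 h.2).choose else false
  let κ₀ : Finset {ℓ // Zhang2014.IsKolyvaginPrime (W.conductorNorm ℤ) W K p ℓ} → Finset (AdmQ W K p) → Vp W K p :=
    fun m n ↦ if h : n.Nonempty ∧ Even n.card then (hsyn n h.1 h.2).choose_spec.choose m else κgen m
  have hκ₀ : ∀ (n : Finset (AdmQ W K p)) (hn : n.Nonempty) (he : Even n.card),
      (∀ m, κ₀ m n ∈ 𝒮 n m (ε₀ n ^^ Nat.bodd m.card)) ∧
      (∀ m, κ₀ m n ≠ 0 ↔ finrank (ZMod p) (𝒮 n m true) + finrank (ZMod p) (𝒮 n m false) = 1) ∧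
      (∀ m ℓ, ℓ ∉ m → (κ₀ (insert ℓ m) n ∈ Z ℓ ↔ κ₀ m n ∈ Z ℓ)) := by
    intro n hn he
    have h : n.Nonempty ∧ Even n.card := ⟨hn, he⟩
    have hε : ε₀ n = (hsyn n h.1 h.2).choose := dif_pos h
    have hκ : ∀ m, κ₀ m n = (hsyn n h.1 h.2).choose_spec.choose m := fun m ↦ by
      simp only [κ₀, dif_pos h]
    simp only [hε, hκ]
    exact (hsyn n h.1 h.2).choose_spec.choose_spec
  have hκ₀_empty : ∀ m, κ₀ m ∅ = κgen m := fun m ↦ by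
    simp only [κ₀, Finset.not_nonempty_empty, false_and, dif_neg, not_false_eq_true]
  -- §f membership consequences at a non-empty even level
  have hmem : ∀ (n : Finset (AdmQ W K p)) (hn : n.Nonempty) (he : Even n.card) (m),
      conjAct W c ((p ^ 1 : ℕ) : ℤ) (κ₀ m n) = sgnP (ε₀ n ^^ Nat.bodd m.card) • κ₀ m n ∧
        (∀ w : InfinitePlace K, κ₀ m n ∈ selmerLocalKer (W.baseChange K) w.Completion ((p ^ 1 : ℕ) : ℤ)) ∧
        (∀ v : HeightOneSpectrum (𝓞 K), (∀ ℓ ∈ m, ((ℓ : ℕ) : 𝓞 K) ∉ v.asIdeal) →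
          (∀ q ∈ n, ((q : ℕ) : 𝓞 K) ∉ v.asIdeal) →
          κ₀ m n ∈ selmerLocalKer (W.baseChange K) (v.adicCompletion K) ((p ^ 1 : ℕ) : ℤ)) ∧
        (∀ q ∈ n, ∀ v : HeightOneSpectrum (𝓞 K), ((q : ℕ) : 𝓞 K) ∈ v.asIdeal →
          κ₀ m n ∈ toricLocalKer (W.baseChange K) (v.adicCompletion K) ((p ^ 1 : ℕ) : ℤ)) ∧
        (∀ ℓ ∈ m, ∀ v : HeightOneSpectrum (𝓞 K), ((ℓ : ℕ) : 𝓞 K) ∈ v.asIdeal →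
          κ₀ m n ∈ transverseLocalKerP W K p ι ℓ v) :=
    fun n hn he m ↦ (h𝒮 n m _ _).mp ((hκ₀ n hn he).1 m)
  -- §g assembly through the even-levels constructor
  refine nonempty_levelKolyvaginSystemP_of_evenLevels W K p c Dt β ι ε₀ κ₀ (fun m ↦ ?_) (fun n hn he m ↦ (hmem n hn he m).1)
    (fun n hn he m v hm hq ↦ (hmem n hn he m).2.2.1 v hm hq) (fun n hn he m w ↦ (hmem n hn he m).2.1 w)
    (fun n hn he m q hq v hv ↦ (hmem n hn he m).2.2.2.1 q hq v hv)
    (fun n hn he m ℓ hℓ v hv ↦ (hmem n hn he m).2.2.2.2 ℓ hℓ v hv) (fun n hn he m ℓ hℓm v hv ↦ ?_)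
    (fun n q₁ q₂ hq₁ hq₂ he hbase ↦ ?_) (fun n hn he h1 ↦ ?_)
  · -- realisation at level `∅`
    rw [hκ₀_empty]
    exact hκgen m
  · -- relation (8.1)
    rw [hplace ℓ v hv, ← hZ, ← hZ]
    exact (hκ₀ n hn he).2.2 m ℓ hℓm
  · -- transport (A2)
    have hne'' : (insert q₂ (insert q₁ n)).Nonempty := Finset.insert_nonempty _ _
    have he'' : Even (insert q₂ (insert q₁ n)).card := (Method2EvenLevels.even_card_insert_insert_iff hq₁ hq₂).mpr he
    obtain ⟨m, v, hv, hdet⟩ := (not_mem_baseLocusQP_iff W K p).mp hbase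
    have hne0 : κ₀ m (insert q₂ (insert q₁ n)) ≠ 0 := ne_zero_of_not_mem_torsionLocalKer W K p hdet
    have h1'' := ((hκ₀ _ hne'' he'').2.1 m).mp hne0
    rcases n.eq_empty_or_nonempty with rfl | hn
    · exact ⟨m₀, by rw [hκ₀_empty]; exact hκgen₀⟩
    · refine ⟨m, ((hκ₀ n hn he).2.1 m).mpr (hTwoStep n q₁ q₂ hn he hq₁ hq₂ m _ h1'' ⟨_, (hκ₀ _ hne'' he'').1 m, v, hv, hdet⟩)⟩
  · -- base case (A5): total canonical rank one ⟹ the synthetic bottom class is a generator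
    refine ((hκ₀ n hn he).2.1 ∅).mpr ?_
    have hS : ∀ μ, 𝒮 n ∅ μ = SelQP W K p c n μ := fun μ ↦ by
      ext x
      rw [h𝒮, mem_selQP_iff]
      simp only [Finset.notMem_empty, IsEmpty.forall_iff, implies_true, forall_const, and_true]
    rw [hS, hS]
    exact h1

/-! ## §2 The intended family exists (the dictionary binder is not a restriction) -/

omit [NeZero (W.conductorNorm ℤ)] in
/-- **The level-`n` eigen-Selmer spaces TRANSVERSE on `m` exist with their membership dictionary and are finite-dimensional**:
`𝒮 n m μ :=` the canonical space `levelSelmerSubgroupP` at level `n` relaxed at the Kolyvagin primes of `m`, cut by the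
transverse conditions `transverseLocalKerP` above them (as a `ZMod p`-subspace). An admissible prime is never a Kolyvagin prime
(`p ∤ q² − 1` versus `p ∣ ℓ + 1`), so the toric clause is unaffected by the relaxation. Finite: a subgroup of the finite
`levelSelmerSubgroupP` (`finite_levelSelmerSubgroupP`). [cite: WZhang2014, §5 (Sel_{𝔭_n}), §8.1 (H¹_tr), Lemma 8.4 (3)] -/
theorem exists_transverseLevelSpaces :
    ∃ 𝒮 : Finset (AdmQ W K p) → Finset {ℓ // Zhang2014.IsKolyvaginPrime (W.conductorNorm ℤ) W K p ℓ} → Bool →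
      Submodule (ZMod p) (Vp W K p),
      (∀ (n : Finset (AdmQ W K p)) (m : Finset {ℓ // Zhang2014.IsKolyvaginPrime (W.conductorNorm ℤ) W K p ℓ})
        (μ : Bool) (x : Vp W K p), x ∈ 𝒮 n m μ ↔
          conjAct W c ((p ^ 1 : ℕ) : ℤ) x = sgnP μ • x ∧
          (∀ w : InfinitePlace K, x ∈ selmerLocalKer (W.baseChange K) w.Completion ((p ^ 1 : ℕ) : ℤ)) ∧
          (∀ v : HeightOneSpectrum (𝓞 K), (∀ ℓ ∈ m, ((ℓ : ℕ) : 𝓞 K) ∉ v.asIdeal) →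
            (∀ q ∈ n, ((q : ℕ) : 𝓞 K) ∉ v.asIdeal) →
            x ∈ selmerLocalKer (W.baseChange K) (v.adicCompletion K) ((p ^ 1 : ℕ) : ℤ)) ∧
          (∀ q ∈ n, ∀ v : HeightOneSpectrum (𝓞 K), ((q : ℕ) : 𝓞 K) ∈ v.asIdeal →
            x ∈ toricLocalKer (W.baseChange K) (v.adicCompletion K) ((p ^ 1 : ℕ) : ℤ)) ∧
          (∀ ℓ ∈ m, ∀ v : HeightOneSpectrum (𝓞 K), ((ℓ : ℕ) : 𝓞 K) ∈ v.asIdeal → x ∈ transverseLocalKerP W K p ι ℓ v)) ∧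
      (∀ n m μ, Module.Finite (ZMod p) (𝒮 n m μ)) := by
  have hp : p.Prime := Fact.out
  -- an admissible prime is not a Kolyvagin prime
  have hdisj : ∀ (q : AdmQ W K p) (ℓ : {ℓ // Zhang2014.IsKolyvaginPrime (W.conductorNorm ℤ) W K p ℓ}), (q : ℕ) ≠ (ℓ : ℕ) := by
    intro q ℓ h
    have hcop := coprime_of_admQ_of_kolyvagin W K p q ℓ.2
    rw [← h, Nat.coprime_self] at hcop
    exact q.2.1.ne_one hcop
  let T : Finset {ℓ // Zhang2014.IsKolyvaginPrime (W.conductorNorm ℤ) W K p ℓ} → AddSubgroup (Vp W K p) := fun m ↦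
    ⨅ (ℓ : {ℓ // Zhang2014.IsKolyvaginPrime (W.conductorNorm ℤ) W K p ℓ}) (_ : ℓ ∈ m) (v : HeightOneSpectrum (𝓞 K))
      (_ : ((ℓ : ℕ) : 𝓞 K) ∈ v.asIdeal), transverseLocalKerP W K p ι ℓ v
  have hT : ∀ m (x : Vp W K p), x ∈ T m ↔
      ∀ ℓ ∈ m, ∀ v : HeightOneSpectrum (𝓞 K), ((ℓ : ℕ) : 𝓞 K) ∈ v.asIdeal → x ∈ transverseLocalKerP W K p ι ℓ v := by
    intro m x
    simp only [T, AddSubgroup.mem_iInf]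
  refine ⟨fun n m μ ↦ AddSubgroup.toZModSubmodule p
      (levelSelmerSubgroupP W K p c (n.image Subtype.val) (↑(m.image Subtype.val)) μ ⊓ T m), fun n m μ x ↦ ?_, fun n m μ ↦ ?_⟩
  · rw [AddSubgroup.mem_toZModSubmodule, AddSubgroup.mem_inf, mem_levelSelmerSubgroupP_iff, hT]
    refine ⟨fun ⟨⟨h1, h2, h3, h4⟩, h5⟩ ↦ ⟨h1, h2, fun v hvm hvn ↦ h3 v fun q hq ↦ ?_, fun q hq v hv ↦ h4 q ⟨?_, ?_⟩ v hv, h5⟩,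
      fun ⟨h1, h2, h3, h4, h5⟩ ↦ ⟨⟨h1, h2, fun v hv ↦ h3 v (fun ℓ hℓ ↦ hv ℓ ?_) (fun q hq ↦ hv q ?_), fun q hq v hv ↦ ?_⟩, h5⟩⟩
    · rcases hq with hq | hq
      · obtain ⟨a, ha, rfl⟩ := Finset.mem_image.mp (Finset.mem_coe.mp hq)
        exact hvn a ha
      · obtain ⟨a, ha, rfl⟩ := Finset.mem_image.mp (Finset.mem_coe.mp hq)
        exact hvm a ha
    · exact Finset.mem_image_of_mem _ hq
    · intro h
      obtain ⟨a, -, ha⟩ := Finset.mem_image.mp (Finset.mem_coe.mp h)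
      exact hdisj q a ha.symm
    · exact Or.inr (Finset.mem_coe.mpr (Finset.mem_image_of_mem _ hℓ))
    · exact Or.inl (Finset.mem_coe.mpr (Finset.mem_image_of_mem _ hq))
    · obtain ⟨a, ha, rfl⟩ := Finset.mem_image.mp hq.1
      exact h4 a ha v hv
  · have hfin : Finite (levelSelmerSubgroupP W K p c (n.image Subtype.val) (↑(m.image Subtype.val)) μ) := by
      refine finite_levelSelmerSubgroupP W K p c _ _ (Finset.finite_toSet _) ?_ μ
      rintro (h | h)
      · obtain ⟨q, -, hq⟩ := Finset.mem_image.mp (Finset.mem_coe.mp h)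
        exact AdmQ.ne_zero W K p q hq
      · obtain ⟨ℓ, -, hℓ⟩ := Finset.mem_image.mp (Finset.mem_coe.mp h)
        exact ℓ.2.1.ne_zero hℓ
    have hfin' : Finite ↥(levelSelmerSubgroupP W K p c (n.image Subtype.val) (↑(m.image Subtype.val)) μ ⊓ T m) :=
      Finite.of_injective _ (AddSubgroup.inclusion_injective inf_le_left)
    have hfin'' : Finite (AddSubgroup.toZModSubmodule p
        (levelSelmerSubgroupP W K p c (n.image Subtype.val) (↑(m.image Subtype.val)) μ ⊓ T m)) :=
      Finite.of_equiv _ (Equiv.setCongr (AddSubgroup.coe_toZModSubmodule p _).symm)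
    exact Module.Finite.of_finite

end Summit.BirchSwinnertonDyer.BirchSwinnertonDyer.Theorems.AdditiveKoly

end
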